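import Summits.HodgeConjecture.HodgeConjecture.Theorems.R90S9HmnAtLevelDatum      -- ★ p862961 (this seat): `hmn_of_levels_of_partner`, `hmn_gammaSph_ofLevelPins`; cone ★ (d) p862762, ★ T2′, ★ LevelPins, ★ Gelfand
import HarnessLib

/-!
# R90-TF · S9 «InnerForm-13.3.6 (c)» — (MN-cm) ON THE DEEP LEVELS: the `hmn` binder at `Γ₀^{sph} = gammaSph X` with the rigidity pin `hrig` asked only above a finite level
# (sibling of ★ `R90S9HmnAtLevelDatum`; Rogawski 1990 p. 242 l. 15–16 «`S′` is chosen large enough», Thm. 14.6.4 proof p. 244)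

Cell `hodgecm-mathlib`, crux H413 (`stmt-HodgeConjecture-24833`, lane `--supports … --as helper`), route of record `HCCMUnconditional` (no route verbs; count-neutral).
Programme R90-TF (brief `director/R90-BRIEF.v2.md` 1f40d54518340a35), section S9 = InnerForm-13.3.6 (c) (base `R90-IF`); seat R90-IF-p07 (g0).  DEALT BY NAME: R90-IF-plan (g2)
DEAL (33-asm) 2026-09-04T23:47:48Z (row-33 assembly at `X_cm`: «`hrig :=` ★ p863121 `gradeRep_eq_of_evpRigidityCore … sock_S9_evpRigidityCore_cm`») — that ★ payer gives
`hrig` only at levels carrying Gelfand vanishing, i.e. above a finite `l₁`; ★ `hmn_gammaSph_ofLevelPins` asked `hrig` at EVERY level.  THIS FILE is the sibling with the one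
binder weakened (a 400-line cap keeps it out of the ★ file).  THEOREMS ONLY: no `def`, no instance, no notation, no named fact, no `sorry`; imports ★ only; namespace
`Summit.HodgeConjecture.HodgeConjecture.R90.S9.InnerFormSec146`.
HONEST LABEL: HC_CM is proved only modulo the 7 printed citations (2 remaining named inputs: hLiu418 = stmt-HodgeConjecture-24832, h413 = stmt-HodgeConjecture-24833) — until
rung 0 closes.  Same content as ★ p862961 §2; every deep input is a HYPOTHESIS paid by name (see that file's docstring).

## What is here (sorry-free, axioms ⊆ {propext, Classical.choice, Quot.sound})
* **`hmn_gammaSph_ofDeepLevelPins`** — ★ `hmn_gammaSph_ofLevelPins` with `(l₁ : Level L) (hrig : ∀ l, l₁ ⊆ l → …)` in place of `(hrig : ∀ l, …)`; conclusion BYTEWISE the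
  `hmn` binder of ★ `sec146_of_parts_mem` at `gammaSph … X`.  Proof: §1 `hmn_of_levels_of_partner` of ★ p862961 on `Λ := {l // l₀ ∪ l₁ ⊆ l}`.
[cite: Rogawski1990, §14.6 Thm. 14.6.4 proof p. 244 l. −14 → −9 (chunk p0238 L12–16), (14.6.1) p. 241, p. 242 l. 10–22 (chunk p0236 L6–11); §13.3 Thm. 13.3.5 p. 202; §13.7 p. 206; Prop. 13.8.1 p. 212]
[cite: LabesseLanglands1979, Lemma 6.1] [cite: CartierCorvallis1979, §IV.1 Cor. 4.1]
-/

set_option autoImplicit false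
set_option linter.dupNamespace false  -- the mandated namespace repeats the summit's segment (`HodgeConjecture.HodgeConjecture`)

noncomputable section

open NumberField IsDedekindDomain MeasureTheory
open scoped Matrix MatrixGroups Classical ComplexOrder
open Literature.NumberTheory Literature.NumberTheory.Automorphic Literature.NumberTheory.Automorphic.UnitaryGroup
open Literature.NumberTheory.Rogawski1990
open Summit.HodgeConjecture.HodgeConjecture.Cruxes.H413 Summit.HodgeConjecture.HodgeConjecture.Cruxes.H413.F0P3ClassTokenChoice
open Summit.HodgeConjecture.HodgeConjecture.Cruxes.H413.F0P3GlobalPacket Summit.HodgeConjecture.HodgeConjecture.Cruxes.H413.F0P3LocalPacketKit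
open Summit.HodgeConjecture.HodgeConjecture.Cruxes.H413.F0P3UnrTensorInstance (UnrTensor)

namespace Summit.HodgeConjecture.HodgeConjecture.R90.S9.InnerFormSec146

section Datum


variable (TG TH : Type) (L : Type) [Field L] [NumberField L] [IsCMField L] (ι : L →+* ℂ) (H : Matrix (Fin 3) (Fin 3) L) (T : GL (Fin 3) ℂ)
  (hT : (T : Matrix (Fin 3) (Fin 3) ℂ)ᴴ * H.map ι * (T : Matrix (Fin 3) (Fin 3) ℂ) = Literature.Geometry.ComplexHyperbolic.BallModel.J)
  (μA : Measure (adelicGroupData (↥(maximalRealSubfield L)) L (IsCMField.complexConj L) 3 H).automorphicQuotient)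
  [(adelicGroupData (↥(maximalRealSubfield L)) L (IsCMField.complexConj L) 3 H).IsAutomorphicMeasure μA]
  (μv : ∀ v : HeightOneSpectrum (𝓞 ↥(maximalRealSubfield L)), @Measure ((cmDatum L 3 H).Local v) (borel _))
  (Ξ : OneDimAutRepH L → PacketPrimeFin L H) {H' : Matrix (Fin 3) (Fin 3) L}
  (𝔩 : ∀ v : HeightOneSpectrum (𝓞 ↥(maximalRealSubfield L)), LocalPacketKit L H' v)
  (X : DatumInputs ((UnitaryGroup.arch (↥(maximalRealSubfield L)) L (IsCMField.complexConj L) 3 H → ℂ) ×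
      (∀ v : HeightOneSpectrum (𝓞 ↥(maximalRealSubfield L)), (cmDatum L 3 H).Local v → ℂ)) TG TH L ι H T hT μA Ξ 𝔩)
  (Transfer : (UnitaryGroup.arch (↥(maximalRealSubfield L)) L (IsCMField.complexConj L) 3 H → ℂ) ×
      (∀ v : HeightOneSpectrum (𝓞 ↥(maximalRealSubfield L)), (cmDatum L 3 H).Local v → ℂ) → TG → Prop)
  (TransferH : (UnitaryGroup.arch (↥(maximalRealSubfield L)) L (IsCMField.complexConj L) 3 H → ℂ) ×
      (∀ v : HeightOneSpectrum (𝓞 ↥(maximalRealSubfield L)), (cmDatum L 3 H).Local v → ℂ) → TH → Prop)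
  (tw : ∀ l : Level L, HeckeOff L H l → TG → TG) (twH : ∀ l : Level L, HeckeOff L H l → TH → TH)

/-- **(MN-cm) ON THE DEEP LEVELS — `hmn_gammaSph_ofDeepLevelPins` (EDITION 2, append-only; R90-IF-plan (g2) DEAL (33-asm) 2026-09-04T23:47:48Z).**  The same payer
shape as `hmn_gammaSph_ofLevelPins` with ONE binder weakened: the e.v.p. rigidity pin `hrig` is asked only at the levels `l ⊇ l₁` above a given finite `l₁` (the proof runs
on `{l // l₀ ∪ l₁ ⊆ l}`, `l₀` = the non-Gelfand places) — so that FILE B's row `hrig` can be the SHARPENED S5 socket of R90-IF-p04 (g2)'s ★ `gradeRep_eq_of_evpRigidityCore`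
(core rigidity + Gelfand vanishing, available exactly at deep levels).  Every other binder and the CONCLUSION (the `hmn` binder of ★ `sec146_of_parts_mem` at `gammaSph … X`) are
BYTEWISE those of `hmn_gammaSph_ofLevelPins`. [cite: Rogawski1990, §14.6 Thm. 14.6.4 proof p. 244 l. −14 → −9 (chunk p0238 L12–16), p. 242 l. 15–16 «`S′` is chosen large enough»; §13.3 Thm. 13.3.5 p. 202] -/
theorem hmn_gammaSph_ofDeepLevelPins
    (hanis : ∀ y : Fin 3 → L, Literature.AlgebraicGeometry.ShimuraVarieties.hermForm (cmConjRingHom L) H y y = 0 → y = 0)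
    (hH : (H.map (cmConjRingHom L))ᵀ = H) (hHd : IsUnit H.det)
    (hμ : ∀ v, letI : MeasurableSpace ((cmDatum L 3 H).Local v) := borel _; (μv v).IsHaarMeasure)
    (hμK1 : ∀ v, μv v (cmLocalIntegralLevel L 3 H v : Set ((cmDatum L 3 H).Local v)) = 1)
    (A : RepPrimeSph L ι H T hT μA → (UnitaryGroup.arch (↥(maximalRealSubfield L)) L (IsCMField.complexConj L) 3 H → ℂ) → ℂ)
    (htrX : ∀ (π' : RepPrimeSph L ι H T hT μA)
        (p : (UnitaryGroup.arch (↥(maximalRealSubfield L)) L (IsCMField.complexConj L) 3 H → ℂ) ×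
          (∀ v : HeightOneSpectrum (𝓞 ↥(maximalRealSubfield L)), (cmDatum L 3 H).Local v → ℂ)),
      X.trPrime π' p = A π' p.1 * ∏ᶠ v, (letI : MeasurableSpace ((cmDatum L 3 H).Local v) := borel _;
        ((tupleOf L ι H T hT μA π').2 v).smoothTrace (μv v) (p.2 v)))
    -- (14.6.1) at `Γ₀^{sph}` [Thm. 14.6.1 p. 241] (pay line: ★ `Ch14Bridge.thm1461_of_thm1451b_of_prop1362`)
    (h61 : (gammaSph _ TG TH L ι H T hT μA Ξ 𝔩 X).thm1461 Transfer TransferH)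
    -- the per-level separation data [p. 242 l. 10–22; §13.7]
    (hχ𝓕 : ∀ (l : Level L) (f' : (UnitaryGroup.arch (↥(maximalRealSubfield L)) L (IsCMField.complexConj L) 3 H → ℂ) ×
        (∀ v : HeightOneSpectrum (𝓞 ↥(maximalRealSubfield L)), (cmDatum L 3 H).Local v → ℂ)), IsLevelTest L ι H T hT l f' →
      Summable (fun π' : RepPrimeSph L ι H T hT μA => (mPrimeSph L ι H T hT μA π' : ℂ) * X.trPrime π' f') ∧
        X.traceL f' = ∑' π' : RepPrimeSph L ι H T hT μA, (mPrimeSph L ι H T hT μA π' : ℂ) * X.trPrime π' f')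
    (hTw : ∀ (l : Level L) (h : HeckeOff L H l) (f' : (UnitaryGroup.arch (↥(maximalRealSubfield L)) L (IsCMField.complexConj L) 3 H → ℂ) ×
        (∀ v : HeightOneSpectrum (𝓞 ↥(maximalRealSubfield L)), (cmDatum L 3 H).Local v → ℂ)) (f : TG),
      IsLevelTest L ι H T hT l f' → Transfer f' f → Transfer (twistTest L H μv l h f') (tw l h f))
    (hTHw : ∀ (l : Level L) (h : HeckeOff L H l) (f' : (UnitaryGroup.arch (↥(maximalRealSubfield L)) L (IsCMField.complexConj L) 3 H → ℂ) ×
        (∀ v : HeightOneSpectrum (𝓞 ↥(maximalRealSubfield L)), (cmDatum L 3 H).Local v → ℂ)) (fH : TH),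
      IsLevelTest L ι H T hT l f' → TransferH f' fH → TransferH (twistTest L H μv l h f') (twH l h fH))
    (hEP : ∀ (l : Level L) (h : HeckeOff L H l) (f' : (UnitaryGroup.arch (↥(maximalRealSubfield L)) L (IsCMField.complexConj L) 3 H → ℂ) ×
        (∀ v : HeightOneSpectrum (𝓞 ↥(maximalRealSubfield L)), (cmDatum L 3 H).Local v → ℂ)) (f : TG), IsLevelTest L ι H T hT l f' → Transfer f' f →
      ∀ P : X.G.Packet, X.G.packetTrace X.tr P (tw l h f) =
        ((gradePacket _ TG TH L ι H T hT μA μv Ξ 𝔩 X l P).elim 0 fun e => evOff L H μv l e h) * X.G.packetTrace X.tr P f)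
    (hEH : ∀ (l : Level L) (h : HeckeOff L H l) (f' : (UnitaryGroup.arch (↥(maximalRealSubfield L)) L (IsCMField.complexConj L) 3 H → ℂ) ×
        (∀ v : HeightOneSpectrum (𝓞 ↥(maximalRealSubfield L)), (cmDatum L 3 H).Local v → ℂ)) (fH : TH), IsLevelTest L ι H T hT l f' → TransferH f' fH →
      ∀ ρ : X.G.PacketH, X.trH ρ (twH l h fH) =
        ((gradePacketH _ TG TH L ι H T hT μA μv Ξ 𝔩 X l ρ).elim 0 fun e => evOff L H μv l e h) * X.trH ρ fH)
    (hsepL : ∀ l : Level L, IsCountablyLinIndepOn (EvpSupport L H μv l) (fun _ : HeckeOff L H l => True) (evOff L H μv l))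
    -- Thm. 13.3.5 at the level, the lift law, `|Π̂| < ∞` [§13.3 Thm. 13.3.2, 13.3.5 pp. 201–203] (S5)
    (htP : ∀ (l : Level L) (P Q : X.G.Packet) (e : Evp L H),
      gradePacket _ TG TH L ι H T hT μA μv Ξ 𝔩 X l P = some e → gradePacket _ TG TH L ι H T hT μA μv Ξ 𝔩 X l Q = some e → P = Q)
    (hliftE : ∀ (l : Level L) (ρ : X.G.PacketH) (P : X.G.Packet) (e : Evp L H), gradePacket _ TG TH L ι H T hT μA μv Ξ 𝔩 X l P = some e →
      (X.G.liftsTo ρ P ↔ gradePacketH _ TG TH L ι H T hT μA μv Ξ 𝔩 X l ρ = some e))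
    (hlifts : ∀ P : X.G.Packet, (X.G.lifts P).Finite)
    -- countable linear independence of characters against a test class `𝓣` [Prop. 13.8.1] (payer ★ p862545 (d2) at the restricted pure tensors) and transfers on it (S3∕S6)
    (𝓣 : (UnitaryGroup.arch (↥(maximalRealSubfield L)) L (IsCMField.complexConj L) 3 H → ℂ) ×
        (∀ v : HeightOneSpectrum (𝓞 ↥(maximalRealSubfield L)), (cmDatum L 3 H).Local v → ℂ) → Prop)
    (hli : IsCountablyLinIndepOn (Set.univ : Set (RepPrimeSph L ι H T hT μA)) 𝓣
      (fun π' p => (gammaSph _ TG TH L ι H T hT μA Ξ 𝔩 X).tr' π' p))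
    (hex : ∀ f' : (UnitaryGroup.arch (↥(maximalRealSubfield L)) L (IsCMField.complexConj L) 3 H → ℂ) ×
        (∀ v : HeightOneSpectrum (𝓞 ↥(maximalRealSubfield L)), (cmDatum L 3 H).Local v → ℂ), 𝓣 f' → ∃ (f : TG) (fH : TH), Transfer f' f ∧ TransferH f' fH)
    -- cofinality of the level datum for the tests of `𝓣` and packets with a discrete e.v.p.-partner [p. 242 l. 15–16 «`S′` is chosen large enough»]
    (hcover : ∀ f' : (UnitaryGroup.arch (↥(maximalRealSubfield L)) L (IsCMField.complexConj L) 3 H → ℂ) ×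
        (∀ v : HeightOneSpectrum (𝓞 ↥(maximalRealSubfield L)), (cmDatum L 3 H).Local v → ℂ), 𝓣 f' → ∀ P : X.G.Packet,
      (∃ π' : RepPrimeSph L ι H T hT μA, mPrimeSph L ι H T hT μA π' ≠ 0 ∧ (gammaSph _ TG TH L ι H T hT μA Ξ 𝔩 X).evpRep π' P) →
      ∀ l₀ : Level L, ∃ l : Level L, l₀ ⊆ l ∧ ∃ e : Evp L H, IsLevelTest L ι H T hT l f' ∧ gradePacket _ TG TH L ι H T hT μA μv Ξ 𝔩 X l P = some e)
    -- e.v.p. rigidity for contributing classes, pointwise per level [p. 242 «Furthermore, `Π` is unique by Theorem 13.3.5»] (payer ★ `hrig_of_levelsTsum_posTest`)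
    (l₁ : Level L)
    (hrig : ∀ (l : Level L), l₁ ⊆ l → ∀ (f' : (UnitaryGroup.arch (↥(maximalRealSubfield L)) L (IsCMField.complexConj L) 3 H → ℂ) ×
        (∀ v : HeightOneSpectrum (𝓞 ↥(maximalRealSubfield L)), (cmDatum L 3 H).Local v → ℂ)), IsLevelTest L ι H T hT l f' →
      ∀ (π' : RepPrimeSph L ι H T hT μA) (P : X.G.Packet) (e : Evp L H), gradePacket _ TG TH L ι H T hT μA μv Ξ 𝔩 X l P = some e →
        (gammaSph _ TG TH L ι H T hT μA Ξ 𝔩 X).evpRep π' P → (mPrimeSph L ι H T hT μA π' : ℂ) * X.trPrime π' f' ≠ 0 →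
          gradeRep L ι H T hT μA μv l π' = some e)
    -- packet laws of the A-packets `Π(ξ)`, `dim ξ = 1` [§13.3 p. 203; Prop. 11.2.1] (S5)
    (hlifts1 : ∀ (P : X.G.Packet) (ξ : X.G.PacketH), X.G.IsAPacket P → X.IsOneDimH ξ → X.G.liftsTo ξ P → X.G.lifts P = {ξ})
    (hn : ∀ (P : X.G.Packet) (ξ : X.G.PacketH), X.G.IsAPacket P → X.IsOneDimH ξ → X.G.liftsTo ξ P → X.G.n P = 1 / 2)
    (hnH : ∀ ξ : X.G.PacketH, X.IsOneDimH ξ → X.G.nH ξ = 1)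
    -- the §14.4 vanishing pins [Props. 14.4.1 (a), 14.4.2 (c)] «JUNCTION PENDING S2» (J6)
    (hvanG : ∀ (P : X.G.Packet) (ξ : X.G.PacketH) (v : Place L), v ∈ S0 L H → X.IsOneDimH ξ → X.G.liftsTo ξ P → ¬ X.MnNeZero ξ v →
      ∀ (f' : (UnitaryGroup.arch (↥(maximalRealSubfield L)) L (IsCMField.complexConj L) 3 H → ℂ) ×
          (∀ v : HeightOneSpectrum (𝓞 ↥(maximalRealSubfield L)), (cmDatum L 3 H).Local v → ℂ)) (f : TG),
        𝓣 f' → Transfer f' f → X.G.packetTrace X.tr P f = 0)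
    (hvanH : ∀ (ξ : X.G.PacketH) (v : Place L), v ∈ S0 L H → X.IsOneDimH ξ → ¬ X.MnNeZero ξ v →
      ∀ (f' : (UnitaryGroup.arch (↥(maximalRealSubfield L)) L (IsCMField.complexConj L) 3 H → ℂ) ×
          (∀ v : HeightOneSpectrum (𝓞 ↥(maximalRealSubfield L)), (cmDatum L 3 H).Local v → ℂ)) (fH : TH),
        𝓣 f' → TransferH f' fH → X.trH ξ fH = 0) :
    (gammaSph _ TG TH L ι H T hT μA Ξ 𝔩 X).DSplit →
      ∀ (P : (gammaSph _ TG TH L ι H T hT μA Ξ 𝔩 X).G.Packet) (ξ : (gammaSph _ TG TH L ι H T hT μA Ξ 𝔩 X).G.PacketH),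
        (gammaSph _ TG TH L ι H T hT μA Ξ 𝔩 X).G.IsAPacket P → (gammaSph _ TG TH L ι H T hT μA Ξ 𝔩 X).IsOneDimH ξ →
        (gammaSph _ TG TH L ι H T hT μA Ξ 𝔩 X).G.liftsTo ξ P →
        (∃ π' : (gammaSph _ TG TH L ι H T hT μA Ξ 𝔩 X).Rep',
          (gammaSph _ TG TH L ι H T hT μA Ξ 𝔩 X).m' π' ≠ 0 ∧ (gammaSph _ TG TH L ι H T hT μA Ξ 𝔩 X).evpRep π' P) →
        ∀ v : (gammaSph _ TG TH L ι H T hT μA Ξ 𝔩 X).Place, v ∈ (gammaSph _ TG TH L ι H T hT μA Ξ 𝔩 X).S₀ →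
          (gammaSph _ TG TH L ι H T hT μA Ξ 𝔩 X).MnNeZero ξ v := by
  -- the finite set of non-Gelfand places: off any deeper level, non-spherical admissible classes kill the spherical Hecke algebra (for `hER`)
  obtain ⟨l₀, hgel⟩ := exists_level_forall_smoothTrace_eq_zero_of_not_isSpherical L H μv hH hHd
    (fun v => letI : MeasurableSpace ((cmDatum L 3 H).Local v) := borel _;
      ⟨(hμ v).toIsMulLeftInvariant, inferInstance⟩)
  -- the `tsum` level identities at every deep level, from (14.6.1) by separation (★ T2′), with the six pins and `hER` discharged
  have hlevT := fun l : {l : Level L // l₀ ∪ l₁ ⊆ l} =>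
    R90.S9.eq1462LevelTsum_of_thm1461_of_separation' (gammaSph _ TG TH L ι H T hT μA Ξ 𝔩 X) Transfer TransferH h61
      (IsLevelTest L ι H T hT l.1) (hχ𝓕 l.1) (evOff L H μv l.1) (EvpSupport L H μv l.1)
      (gradeRep L ι H T hT μA μv l.1) (gradePacket _ TG TH L ι H T hT μA μv Ξ 𝔩 X l.1) (gradePacketH _ TG TH L ι H T hT μA μv Ξ 𝔩 X l.1)
      (fun π' e h => gradeRep_mem_evpSupport L ι H T hT μA μv l.1 π' e h)
      (fun P e h => gradePacket_mem_evpSupport TG TH L ι H T hT μA μv Ξ 𝔩 X l.1 P e h)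
      (fun ρ e h => gradePacketH_mem_evpSupport TG TH L ι H T hT μA μv Ξ 𝔩 X l.1 ρ e h)
      (twistTest L H μv l.1) (tw l.1) (twH l.1)
      (fun h f' hf' => isLevelTest_twistTest L ι H T hT μv
        (fun v => letI : MeasurableSpace ((cmDatum L 3 H).Local v) := borel _; (hμ v).toIsMulLeftInvariant) l.1 h f' hf')
      (hTw l.1) (hTHw l.1)
      (fun h f' hf' π' => trPrime_twistTest_eq_of_factorised L ι H T hT μA μv TG TH Ξ 𝔩 X hanis hμ hμK1 A htrX l.1
        (fun v hv c hc => hgel l.1 (Finset.subset_union_left.trans l.2) v hv c hc) h f' hf' π')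
      (hEP l.1) (hEH l.1) (hsepL l.1) (htP l.1) (hliftE l.1) hlifts
  exact R90.S9.hmn_of_levels_of_partner (gammaSph _ TG TH L ι H T hT μA Ξ 𝔩 X) Transfer TransferH 𝓣 Set.univ
    (fun π' _ => Set.mem_univ π') hli hex
    (Λ := {l : Level L // l₀ ∪ l₁ ⊆ l})
    (fun l => IsLevelTest L ι H T hT l.1)
    (fun l => gradeRep L ι H T hT μA μv l.1) (fun l => gradePacket _ TG TH L ι H T hT μA μv Ξ 𝔩 X l.1)
    (fun f' hF P hP => by
      obtain ⟨l, hl, e, hFl, hPl⟩ := hcover f' hF P hP (l₀ ∪ l₁)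
      exact ⟨⟨l, hl⟩, e, hFl, hPl⟩)
    (fun l => R90.S9.hasSum_fibre_indicator_of_tsum_eq (gammaSph _ TG TH L ι H T hT μA Ξ 𝔩 X) Transfer TransferH
      (IsLevelTest L ι H T hT l.1) (gradeRep L ι H T hT μA μv l.1) (gradePacket _ TG TH L ι H T hT μA μv Ξ 𝔩 X l.1)
      (fun f' h => (hχ𝓕 l.1 f' h).1) (hlevT l))
    (fun l π' P e hP hπ => evpRep_gammaSph_of_grade_eq TG TH L ι H T hT μA μv Ξ 𝔩 X hμ l.1 π' P e hP hπ)
    (fun l f' hF π' P e hP hevp hne => hrig l.1 (Finset.subset_union_right.trans l.2) f' hF π' P e hP hevp hne)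
    hlifts1 hn hnH hvanG hvanH

end Datum

end Summit.HodgeConjecture.HodgeConjecture.R90.S9.InnerFormSec146

end
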